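import Literature.Analysis.Calculus.SmoothCutoff
import Literature.Analysis.FluidPDE.CarlemanFirst
import HarnessLib

/-!
# Cut-off functions for the backward-uniqueness argument (Seregin 2014, App. A.2–A.3)

Analysis/FluidPDE support file (theorems only) in the backward-uniqueness track of **ns.S08**
(`Literature.Analysis.FluidPDE.ess_endpoint` ⇐ … ⇐ `ess_backward_uniqueness`, ESS 2003 Thm. 5.1 =
Seregin 2014, Thm. A.3.5). The proofs of Seregin's Lemmas A.1–A.3 apply the two Carleman
inequalities (`Carleman.carleman_inequality_first_of_contDiff_two`,
`Carleman.carleman_inequality_second_of_contDiff_two`) to products `w = η v` of a `C²` function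
`v` with smooth cut-offs `η` built from one-variable steps: in time (`φ_t(s)`, `φ_ε(s)`), in the
radius (`φ_ρ(y)`, through `|y|²`), and in a coordinate. This file provides the one-variable
smooth step with scale-invariant bounds on its first two derivatives and the calculus of the
induced space–time cut-offs in the frame operators `Carleman.dt`, `Carleman.dx`, `Carleman.lap`,
`Carleman.gradSq` of `CarlemanCalculus.lean`:

* `Carleman.exists_smooth_step` — for `a < b` a smooth `χ : ℝ → ℝ`, `χ = 0` on `(-∞, a]`,
  `χ = 1` on `[b, ∞)`, `0 ≤ χ ≤ 1`, `|χ'| ≤ D₁/(b-a)`, `|χ''| ≤ D₂/(b-a)²`, `χ' = χ'' = 0` off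
  `[a, b]` (`χ(s) = S((s-a)/(b-a))`, `S` = `Real.smoothTransition`);
* time profiles `z ↦ τ(z.1)` and radial profiles `z ↦ χ(‖z.2‖²)`: their `dt`, `dx`, `lap`,
  `gradSq` (`Carleman.dx_radial`, `Carleman.lap_radial`, `Carleman.gradSq_radial`, …);
* products of scalar cut-offs and the pointwise bounds for `w = η • v`:
  `gradSq (η • v) ≤ 2η² gradSq v + 2 gradSq η ‖v‖²`, `η² gradSq v ≤ 2 gradSq (η • v) + 2 gradSq η ‖v‖²`,
  `‖Σᵢ ∂ᵢη ∂ᵢv‖² ≤ gradSq η · gradSq v`.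

All statements are proved; no definitions.

## References

* G. Seregin, *Lecture notes on regularity theory for the Navier–Stokes equations*, World
  Scientific 2014, App. A.2 (proof of Lemma A.1: the cut-offs `φ`, `φ_ε`), App. A.3 (proof of
  Lemma A.2: `φ_ρ`, `φ_t`; proof of Lemma A.3: `ψ₁`, `ψ₂`). [Seregin2014]
-/

noncomputable section

open Set Function Filter Metric
open _root_.Topology
open scoped InnerProductSpace RealInnerProductSpace

namespace Literature.Analysis.FluidPDE

namespace Carleman

/-! ### The one-variable smooth step -/

section Step

/-- The second derivative of `Real.smoothTransition` vanishes on `(-∞, 0)` (the first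
derivative is identically zero there). [folklore] -/
theorem deriv_deriv_smoothTransition_of_neg {t : ℝ} (ht : t < 0) :
    deriv (deriv Real.smoothTransition) t = 0 := by
  have hev : deriv Real.smoothTransition =ᶠ[𝓝 t] fun _ => 0 := by
    filter_upwards [(isOpen_lt continuous_id continuous_const).mem_nhds ht] with s hs
    exact Calculus.deriv_smoothTransition_of_nonpos (le_of_lt hs)
  rw [hev.deriv_eq]
  simp

/-- The second derivative of `Real.smoothTransition` vanishes on `(1, ∞)`. [folklore] -/
theorem deriv_deriv_smoothTransition_of_one_lt {t : ℝ} (ht : 1 < t) :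
    deriv (deriv Real.smoothTransition) t = 0 := by
  have hev : deriv Real.smoothTransition =ᶠ[𝓝 t] fun _ => 0 := by
    filter_upwards [(isOpen_lt continuous_const continuous_id).mem_nhds ht] with s hs
    exact Calculus.deriv_smoothTransition_of_one_le (le_of_lt hs)
  rw [hev.deriv_eq]
  simp

/-- The second derivative of `Real.smoothTransition` is bounded on `ℝ`. [folklore] -/
theorem exists_bound_deriv_deriv_smoothTransition :
    ∃ D : ℝ, 0 ≤ D ∧ ∀ t, |deriv (deriv Real.smoothTransition) t| ≤ D := by
  have hc : Continuous (deriv (deriv Real.smoothTransition)) := by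
    have h1 : ContDiff ℝ (⊤ : ℕ∞) (deriv Real.smoothTransition) := by
      simpa using (Real.smoothTransition.contDiff (n := ⊤)).iterate_deriv 1
    exact h1.continuous_deriv (by simp)
  obtain ⟨C, hC⟩ := isCompact_Icc.exists_bound_of_continuousOn (hc.continuousOn (s := Icc 0 1))
  refine ⟨max C 0, le_max_right _ _, fun t => ?_⟩
  rcases lt_or_ge t 0 with h0 | h0
  · rw [deriv_deriv_smoothTransition_of_neg h0, abs_zero]
    exact le_max_right _ _
  rcases lt_or_ge 1 t with h1 | h1
  · rw [deriv_deriv_smoothTransition_of_one_lt h1, abs_zero]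
    exact le_max_right _ _
  exact ((Real.norm_eq_abs _).symm.le.trans (hC t ⟨h0, h1⟩)).trans (le_max_left _ _)

/-- **The smooth step at scale `b - a`.** There are absolute constants `D₁, D₂ ≥ 0` such that
for all `a < b` there is a smooth `χ : ℝ → ℝ` with `χ = 0` on `(-∞, a]`, `χ = 1` on `[b, ∞)`,
`0 ≤ χ ≤ 1`, `|χ'| ≤ D₁/(b - a)`, `|χ''| ≤ D₂/(b - a)²`, and `χ' = χ'' = 0` off `[a, b]`
(`χ(s) = S((s - a)/(b - a))` with `S` Mathlib's `Real.smoothTransition`; these are the profiles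
`φ_ε`, `φ_t`, `ψ₁`, `ψ₂` of Seregin 2014, App. A). [folklore] -/
theorem exists_smooth_step : ∃ D₁ D₂ : ℝ, 0 ≤ D₁ ∧ 0 ≤ D₂ ∧ ∀ a b : ℝ, a < b →
    ∃ χ : ℝ → ℝ, ContDiff ℝ (⊤ : ℕ∞) χ ∧ (∀ s, s ≤ a → χ s = 0) ∧ (∀ s, b ≤ s → χ s = 1) ∧
      (∀ s, 0 ≤ χ s) ∧ (∀ s, χ s ≤ 1) ∧
      (∀ s, |deriv χ s| ≤ D₁ / (b - a)) ∧ (∀ s, |deriv (deriv χ) s| ≤ D₂ / (b - a) ^ 2) ∧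
      (∀ s, s < a ∨ b < s → deriv χ s = 0) ∧ (∀ s, s < a ∨ b < s → deriv (deriv χ) s = 0) := by
  obtain ⟨D₁, hD₁, hb₁⟩ := Calculus.exists_bound_deriv_smoothTransition
  obtain ⟨D₂, hD₂, hb₂⟩ := exists_bound_deriv_deriv_smoothTransition
  refine ⟨D₁, D₂, hD₁, hD₂, fun a b hab => ?_⟩
  set ℓ : ℝ := b - a with hℓ
  have hℓ0 : 0 < ℓ := sub_pos.2 hab
  set L : ℝ → ℝ := fun s => (s - a) / ℓ with hL
  have hLd : ∀ s, HasDerivAt L (1 / ℓ) s := fun s => by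
    have := ((hasDerivAt_id s).sub_const a).div_const ℓ
    simpa [hL] using this
  have hLs : ContDiff ℝ (⊤ : ℕ∞) L := (contDiff_id.sub contDiff_const).div_const _
  set χ : ℝ → ℝ := fun s => Real.smoothTransition (L s) with hχ
  have hSd : ∀ u, HasDerivAt Real.smoothTransition (deriv Real.smoothTransition u) u := fun u =>
    (Calculus.differentiable_smoothTransition u).hasDerivAt
  -- first derivative
  have hd1 : ∀ s, HasDerivAt χ (deriv Real.smoothTransition (L s) * (1 / ℓ)) s := fun s =>
    (hSd (L s)).comp s (hLd s)
  have hd1' : deriv χ = fun s => deriv Real.smoothTransition (L s) * (1 / ℓ) :=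
    funext fun s => (hd1 s).deriv
  -- second derivative
  have hS1 : ContDiff ℝ (⊤ : ℕ∞) (deriv Real.smoothTransition) := by
    simpa using (Real.smoothTransition.contDiff (n := ⊤)).iterate_deriv 1
  have hS1d : ∀ u, HasDerivAt (deriv Real.smoothTransition)
      (deriv (deriv Real.smoothTransition) u) u := fun u =>
    ((hS1.differentiable (by simp)) u).hasDerivAt
  have hd2 : ∀ s, HasDerivAt (deriv χ)
      (deriv (deriv Real.smoothTransition) (L s) * (1 / ℓ) * (1 / ℓ)) s := fun s => by
    rw [hd1']
    exact ((hS1d (L s)).comp s (hLd s)).mul_const _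
  have hd2' : deriv (deriv χ) = fun s =>
      deriv (deriv Real.smoothTransition) (L s) * (1 / ℓ) * (1 / ℓ) :=
    funext fun s => (hd2 s).deriv
  refine ⟨χ, Real.smoothTransition.contDiff.comp hLs, ?_, ?_, ?_, ?_, ?_, ?_, ?_, ?_⟩
  · intro s hs
    apply Real.smoothTransition.zero_of_nonpos
    exact div_nonpos_of_nonpos_of_nonneg (by linarith) hℓ0.le
  · intro s hs
    apply Real.smoothTransition.one_of_one_le
    rw [hL, one_le_div hℓ0]
    simp only [hℓ]; linarith
  · exact fun s => Real.smoothTransition.nonneg _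
  · exact fun s => Real.smoothTransition.le_one _
  · intro s
    rw [hd1', abs_mul, abs_of_pos (by positivity : (0 : ℝ) < 1 / ℓ)]
    calc |deriv Real.smoothTransition (L s)| * (1 / ℓ) ≤ D₁ * (1 / ℓ) :=
          mul_le_mul_of_nonneg_right (hb₁ _) (by positivity)
      _ = D₁ / (b - a) := by rw [hℓ]; ring
  · intro s
    rw [hd2', abs_mul, abs_mul, abs_of_pos (by positivity : (0 : ℝ) < 1 / ℓ)]
    calc |deriv (deriv Real.smoothTransition) (L s)| * (1 / ℓ) * (1 / ℓ) ≤ D₂ * (1 / ℓ) * (1 / ℓ) := by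
          gcongr; exact hb₂ _
      _ = D₂ / (b - a) ^ 2 := by rw [hℓ]; field_simp
  · rintro s (hs | hs)
    · have h0 : deriv Real.smoothTransition (L s) = 0 :=
        Calculus.deriv_smoothTransition_of_nonpos
          (div_nonpos_of_nonpos_of_nonneg (by linarith) hℓ0.le)
      simp [hd1', h0]
    · have h0 : deriv Real.smoothTransition (L s) = 0 := by
        refine Calculus.deriv_smoothTransition_of_one_le ?_
        rw [hL, one_le_div hℓ0]; simp only [hℓ]; linarith
      simp [hd1', h0]
  · rintro s (hs | hs)
    · have h0 : deriv (deriv Real.smoothTransition) (L s) = 0 :=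
        deriv_deriv_smoothTransition_of_neg (div_neg_of_neg_of_pos (by linarith) hℓ0)
      simp [hd2', h0]
    · have h0 : deriv (deriv Real.smoothTransition) (L s) = 0 := by
        refine deriv_deriv_smoothTransition_of_one_lt ?_
        rw [hL, one_lt_div hℓ0]; simp only [hℓ]; linarith
      simp [hd2', h0]

end Step


/-! ### Chain and product rules for scalar space–time functions -/

section ScalarCalculus

variable {E : Type*} [NormedAddCommGroup E] [InnerProductSpace ℝ E]

/-- **Chain rule** for `z ↦ χ(g z)` along `v`: `D(χ ∘ g)(z) v = χ'(g z) · Dg(z) v`. [folklore] -/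
theorem fderiv_comp_scalar_apply {χ : ℝ → ℝ} {g : ℝ × E → ℝ} {z : ℝ × E}
    (hχ : DifferentiableAt ℝ χ (g z)) (hg : DifferentiableAt ℝ g z) (v : ℝ × E) :
    fderiv ℝ (fun y => χ (g y)) z v = deriv χ (g z) * fderiv ℝ g z v := by
  have h : HasFDerivAt (fun y => χ (g y))
      ((ContinuousLinearMap.smulRight (1 : ℝ →L[ℝ] ℝ) (deriv χ (g z))).comp (fderiv ℝ g z)) z :=
    hχ.hasDerivAt.hasFDerivAt.comp z hg.hasFDerivAt
  rw [h.fderiv]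
  simp [mul_comm]

/-- `∂ₜ(χ ∘ g) = χ'(g) ∂ₜg`. [folklore] -/
theorem dt_comp_scalar {χ : ℝ → ℝ} {g : ℝ × E → ℝ} {z : ℝ × E}
    (hχ : DifferentiableAt ℝ χ (g z)) (hg : DifferentiableAt ℝ g z) :
    dt (fun y => χ (g y)) z = deriv χ (g z) * dt g z := by
  simp only [dt_apply]; exact fderiv_comp_scalar_apply hχ hg _

/-- `∂ₑ(χ ∘ g) = χ'(g) ∂ₑg`. [folklore] -/
theorem dx_comp_scalar {χ : ℝ → ℝ} {g : ℝ × E → ℝ} {z : ℝ × E}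
    (hχ : DifferentiableAt ℝ χ (g z)) (hg : DifferentiableAt ℝ g z) (e : E) :
    dx e (fun y => χ (g y)) z = deriv χ (g z) * dx e g z := by
  simp only [dx_apply]; exact fderiv_comp_scalar_apply hχ hg _

/-- **Second derivatives of `χ ∘ g`** along the frame: for `χ ∈ C²(ℝ)` and `g` of class `C²` on
an open set `Ω ∋ z`,
`∂ₑ∂ₑ'(χ ∘ g)(z) = χ''(g z) ∂ₑg ∂ₑ'g + χ'(g z) ∂ₑ∂ₑ'g`. [folklore] -/
theorem dx_dx_comp_scalar {χ : ℝ → ℝ} {g : ℝ × E → ℝ} {Ω : Set (ℝ × E)} {z : ℝ × E}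
    (hΩ : IsOpen Ω) (hz : z ∈ Ω) (hχ : ContDiff ℝ 2 χ) (hg : ContDiffOn ℝ 2 g Ω) (e e' : E) :
    dx e (dx e' fun y => χ (g y)) z =
      deriv (deriv χ) (g z) * dx e g z * dx e' g z + deriv χ (g z) * dx e (dx e' g) z := by
  have hχd : Differentiable ℝ χ := hχ.differentiable (by norm_num)
  have hχ1 : ContDiff ℝ 1 (deriv χ) := by simpa using hχ.iterate_deriv' 1 1
  have hχ'd : Differentiable ℝ (deriv χ) := hχ1.differentiable one_ne_zero
  have hgd : ∀ y ∈ Ω, DifferentiableAt ℝ g y := fun y hy =>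
    (hg.differentiableOn (by norm_num)).differentiableAt (hΩ.mem_nhds hy)
  -- near `z`, `dx e' (χ ∘ g) = (χ' ∘ g) · dx e' g`
  have hev : dx e' (fun y => χ (g y)) =ᶠ[𝓝 z] fun y => deriv χ (g y) * dx e' g y := by
    filter_upwards [hΩ.mem_nhds hz] with y hy
    exact dx_comp_scalar (hχd _) (hgd y hy) e'
  have hdg : DifferentiableAt ℝ (dx e' g) z := by
    have hc : ContDiffOn ℝ 1 (fun y => fderiv ℝ g y (0, e')) Ω :=
      (hg.fderiv_of_isOpen hΩ le_rfl).clm_apply contDiffOn_const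
    exact (hc.differentiableOn one_ne_zero).differentiableAt (hΩ.mem_nhds hz)
  have h1 : DifferentiableAt ℝ (fun y => deriv χ (g y)) z := (hχ'd _).comp z (hgd z hz)
  rw [dx_apply, hev.fderiv_eq, fderiv_fun_mul h1 hdg]
  simp only [_root_.add_apply, FunLike.coe_smul, Pi.smul_apply,
    smul_eq_mul]
  rw [fderiv_comp_scalar_apply (hχ'd _) (hgd z hz)]
  simp only [← dx_apply]
  ring

variable [FiniteDimensional ℝ E]

/-- `Δₓ(χ ∘ g) = χ''(g) |∇ₓg|² + χ'(g) Δₓg` at a point of an open set where `g` is `C²`. [folklore] -/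
theorem lap_comp_scalar {χ : ℝ → ℝ} {g : ℝ × E → ℝ} {Ω : Set (ℝ × E)} {z : ℝ × E}
    (hΩ : IsOpen Ω) (hz : z ∈ Ω) (hχ : ContDiff ℝ 2 χ) (hg : ContDiffOn ℝ 2 g Ω) :
    lap (fun y => χ (g y)) z = deriv (deriv χ) (g z) * gradSq g z + deriv χ (g z) * lap g z := by
  simp only [lap, gradSq, Finset.mul_sum, ← Finset.sum_add_distrib]
  refine Finset.sum_congr rfl fun i _ => ?_
  rw [dx_dx_comp_scalar hΩ hz hχ hg]
  simp only [Real.norm_eq_abs, sq_abs]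
  ring

/-- `|∇ₓ(χ ∘ g)|² = χ'(g)² |∇ₓg|²`. [folklore] -/
theorem gradSq_comp_scalar {χ : ℝ → ℝ} {g : ℝ × E → ℝ} {z : ℝ × E}
    (hχ : DifferentiableAt ℝ χ (g z)) (hg : DifferentiableAt ℝ g z) :
    gradSq (fun y => χ (g y)) z = deriv χ (g z) ^ 2 * gradSq g z := by
  simp only [gradSq, Finset.mul_sum]
  refine Finset.sum_congr rfl fun i _ => ?_
  rw [dx_comp_scalar hχ hg]
  simp only [Real.norm_eq_abs, sq_abs]
  ring

omit [FiniteDimensional ℝ E] in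
/-- **Product rule**, time derivative: `∂ₜ(fh) = f ∂ₜh + h ∂ₜf`. [folklore] -/
theorem dt_mul {f h : ℝ × E → ℝ} {z : ℝ × E} (hf : DifferentiableAt ℝ f z)
    (hh : DifferentiableAt ℝ h z) :
    dt (fun y => f y * h y) z = f z * dt h z + h z * dt f z := by
  simp only [dt_apply]
  rw [fderiv_fun_mul hf hh]
  simp only [_root_.add_apply, FunLike.coe_smul, Pi.smul_apply, smul_eq_mul]

omit [FiniteDimensional ℝ E] in
/-- **Product rule**, spatial derivative: `∂ₑ(fh) = f ∂ₑh + h ∂ₑf`. [folklore] -/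
theorem dx_mul {f h : ℝ × E → ℝ} {z : ℝ × E} (hf : DifferentiableAt ℝ f z)
    (hh : DifferentiableAt ℝ h z) (e : E) :
    dx e (fun y => f y * h y) z = f z * dx e h z + h z * dx e f z := by
  simp only [dx_apply]
  rw [fderiv_fun_mul hf hh]
  simp only [_root_.add_apply, FunLike.coe_smul, Pi.smul_apply, smul_eq_mul]

omit [FiniteDimensional ℝ E] in
/-- Second spatial derivatives of a product of `C²` functions on an open set:
`∂ₑ∂ₑ(fh) = f ∂ₑ∂ₑh + 2 ∂ₑf ∂ₑh + h ∂ₑ∂ₑf`. [folklore] -/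
theorem dx_dx_mul {f h : ℝ × E → ℝ} {Ω : Set (ℝ × E)} {z : ℝ × E} (hΩ : IsOpen Ω) (hz : z ∈ Ω)
    (hf : ContDiffOn ℝ 2 f Ω) (hh : ContDiffOn ℝ 2 h Ω) (e : E) :
    dx e (dx e fun y => f y * h y) z =
      f z * dx e (dx e h) z + 2 * (dx e f z * dx e h z) + h z * dx e (dx e f) z := by
  have hfd : ∀ y ∈ Ω, DifferentiableAt ℝ f y := fun y hy =>
    (hf.differentiableOn (by norm_num)).differentiableAt (hΩ.mem_nhds hy)
  have hhd : ∀ y ∈ Ω, DifferentiableAt ℝ h y := fun y hy =>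
    (hh.differentiableOn (by norm_num)).differentiableAt (hΩ.mem_nhds hy)
  have hdx : ∀ {k : ℝ × E → ℝ}, ContDiffOn ℝ 2 k Ω → DifferentiableAt ℝ (dx e k) z := by
    intro k hk
    have hc : ContDiffOn ℝ 1 (fun y => fderiv ℝ k y (0, e)) Ω :=
      (hk.fderiv_of_isOpen hΩ le_rfl).clm_apply contDiffOn_const
    exact (hc.differentiableOn one_ne_zero).differentiableAt (hΩ.mem_nhds hz)
  have hev : dx e (fun y => f y * h y) =ᶠ[𝓝 z] fun y => f y * dx e h y + h y * dx e f y := by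
    filter_upwards [hΩ.mem_nhds hz] with y hy
    exact dx_mul (hfd y hy) (hhd y hy) e
  rw [dx_apply, hev.fderiv_eq,
    fderiv_fun_add ((hfd z hz).fun_mul (hdx hh)) ((hhd z hz).fun_mul (hdx hf)),
    fderiv_fun_mul (hfd z hz) (hdx hh), fderiv_fun_mul (hhd z hz) (hdx hf)]
  simp only [_root_.add_apply, FunLike.coe_smul, Pi.smul_apply,
    smul_eq_mul, ← dx_apply]
  ring

/-- **Product rule for the Laplacian**: `Δ(fh) = f Δh + h Δf + 2 Σᵢ ∂ᵢf ∂ᵢh`. [folklore] -/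
theorem lap_mul {f h : ℝ × E → ℝ} {Ω : Set (ℝ × E)} {z : ℝ × E} (hΩ : IsOpen Ω) (hz : z ∈ Ω)
    (hf : ContDiffOn ℝ 2 f Ω) (hh : ContDiffOn ℝ 2 h Ω) :
    lap (fun y => f y * h y) z = f z * lap h z + h z * lap f z +
      2 * ∑ i, dx (stdOrthonormalBasis ℝ E i) f z * dx (stdOrthonormalBasis ℝ E i) h z := by
  simp only [lap, Finset.mul_sum, ← Finset.sum_add_distrib]
  refine Finset.sum_congr rfl fun i _ => ?_
  rw [dx_dx_mul hΩ hz hf hh]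
  ring

/-- **Cauchy–Schwarz for the gradient pairing**: `|Σᵢ ∂ᵢf ∂ᵢh| ≤ √|∇f|² √|∇h|²`. [folklore] -/
theorem abs_sum_dx_mul_dx_le (f h : ℝ × E → ℝ) (z : ℝ × E) :
    |∑ i, dx (stdOrthonormalBasis ℝ E i) f z * dx (stdOrthonormalBasis ℝ E i) h z| ≤
      Real.sqrt (gradSq f z) * Real.sqrt (gradSq h z) := by
  calc |∑ i, dx (stdOrthonormalBasis ℝ E i) f z * dx (stdOrthonormalBasis ℝ E i) h z|
      ≤ ∑ i, |dx (stdOrthonormalBasis ℝ E i) f z * dx (stdOrthonormalBasis ℝ E i) h z| :=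
        Finset.abs_sum_le_sum_abs _ _
    _ = ∑ i, |dx (stdOrthonormalBasis ℝ E i) f z| * |dx (stdOrthonormalBasis ℝ E i) h z| := by
        simp [abs_mul]
    _ ≤ Real.sqrt (∑ i, |dx (stdOrthonormalBasis ℝ E i) f z| ^ 2) *
          Real.sqrt (∑ i, |dx (stdOrthonormalBasis ℝ E i) h z| ^ 2) :=
        Real.sum_mul_le_sqrt_mul_sqrt _ _ _
    _ = Real.sqrt (gradSq f z) * Real.sqrt (gradSq h z) := by
        simp [gradSq, Real.norm_eq_abs, sq_abs]

/-- **Gradient of a product**: `|∇(fh)|² ≤ 2 f² |∇h|² + 2 h² |∇f|²`. [folklore] -/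
theorem gradSq_mul_le {f h : ℝ × E → ℝ} {z : ℝ × E} (hf : DifferentiableAt ℝ f z)
    (hh : DifferentiableAt ℝ h z) :
    gradSq (fun y => f y * h y) z ≤ 2 * f z ^ 2 * gradSq h z + 2 * h z ^ 2 * gradSq f z := by
  simp only [gradSq, Finset.mul_sum, ← Finset.sum_add_distrib]
  refine Finset.sum_le_sum fun i _ => ?_
  rw [dx_mul hf hh]
  simp only [Real.norm_eq_abs, sq_abs]
  nlinarith [sq_nonneg (f z * dx (stdOrthonormalBasis ℝ E i) h z - h z * dx (stdOrthonormalBasis ℝ E i) f z)]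

end ScalarCalculus

/-! ### Time profiles and radial profiles -/

section Profiles

variable {E : Type*} [NormedAddCommGroup E] [InnerProductSpace ℝ E]

/-- `∂ₜ` of a time profile: `dt (τ ∘ t) = τ'`. [folklore] -/
theorem dt_timeProfile {τ : ℝ → ℝ} (hτ : ContDiff ℝ 1 τ) (z : ℝ × E) :
    dt (fun y : ℝ × E => τ y.1) z = deriv τ z.1 := by
  rw [dt_apply, fderiv_comp_fst_apply hτ]; simp

/-- `∂ₑ` of a time profile vanishes. [folklore] -/
theorem dx_timeProfile {τ : ℝ → ℝ} (hτ : ContDiff ℝ 1 τ) (e : E) (z : ℝ × E) :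
    dx e (fun y : ℝ × E => τ y.1) z = 0 := by
  rw [dx_apply, fderiv_comp_fst_apply hτ]; simp

/-- `Δₓ` of a time profile vanishes. [folklore] -/
theorem lap_timeProfile [FiniteDimensional ℝ E] {τ : ℝ → ℝ} (hτ : ContDiff ℝ 1 τ) (z : ℝ × E) :
    lap (fun y : ℝ × E => τ y.1) z = 0 := by
  simp only [lap]
  refine Finset.sum_eq_zero fun i _ => ?_
  have h : dx (stdOrthonormalBasis ℝ E i) (fun y : ℝ × E => τ y.1) = fun _ => 0 :=
    funext fun y => dx_timeProfile hτ _ y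
  rw [h]; simp [dx]

/-- `|∇ₓ|²` of a time profile vanishes. [folklore] -/
theorem gradSq_timeProfile [FiniteDimensional ℝ E] {τ : ℝ → ℝ} (hτ : ContDiff ℝ 1 τ)
    (z : ℝ × E) : gradSq (fun y : ℝ × E => τ y.1) z = 0 := by
  simp only [gradSq, dx_timeProfile hτ]
  simp

/-- `∂ₜ |x|² = 0`. [folklore] -/
theorem dt_norm_sq_snd (z : ℝ × E) : dt (fun y : ℝ × E => ‖y.2‖ ^ 2) z = 0 := by
  rw [dt_apply, fderiv_norm_sq_snd_apply]; simp

/-- `∂ₑ |x|² = 2⟪x, e⟫`. [folklore] -/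
theorem dx_norm_sq_snd (e : E) (z : ℝ × E) :
    dx e (fun y : ℝ × E => ‖y.2‖ ^ 2) z = 2 * ⟪z.2, e⟫ := by
  rw [dx_apply, fderiv_norm_sq_snd_apply]

/-- `∂ₑ∂ₑ |x|² = 2 ‖e‖²`. [folklore] -/
theorem dx_dx_norm_sq_snd (e : E) (z : ℝ × E) :
    dx e (dx e fun y : ℝ × E => ‖y.2‖ ^ 2) z = 2 * ‖e‖ ^ 2 := by
  have h : dx e (fun y : ℝ × E => ‖y.2‖ ^ 2) = fun y => 2 * ⟪y.2, e⟫ :=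
    funext fun y => dx_norm_sq_snd e y
  rw [h, dx_apply, fderiv_const_mul ((contDiff_inner_snd_const e (n := 1)).differentiable one_ne_zero _)]
  simp only [FunLike.coe_smul, Pi.smul_apply, smul_eq_mul]
  rw [fderiv_inner_snd_const]
  simp

variable [FiniteDimensional ℝ E]

/-- `|∇ₓ |x|²|² = 4 |x|²`. [folklore] -/
theorem gradSq_norm_sq_snd (z : ℝ × E) : gradSq (fun y : ℝ × E => ‖y.2‖ ^ 2) z = 4 * ‖z.2‖ ^ 2 := by
  simp only [gradSq, dx_norm_sq_snd, Real.norm_eq_abs, sq_abs, mul_pow]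
  rw [← Finset.mul_sum, (stdOrthonormalBasis ℝ E).sum_sq_inner_left]
  norm_num

/-- `Δₓ |x|² = 2 dim E`. [folklore] -/
theorem lap_norm_sq_snd (z : ℝ × E) :
    lap (fun y : ℝ × E => ‖y.2‖ ^ 2) z = 2 * (Module.finrank ℝ E : ℝ) := by
  simp only [lap, dx_dx_norm_sq_snd, (stdOrthonormalBasis ℝ E).orthonormal.1]
  simp [mul_comm]

omit [FiniteDimensional ℝ E] in
/-- **Radial profiles**, time derivative: `∂ₜ χ(|x|²) = 0`. [folklore] -/
theorem dt_radial {χ : ℝ → ℝ} (hχ : Differentiable ℝ χ) (z : ℝ × E) :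
    dt (fun y : ℝ × E => χ (‖y.2‖ ^ 2)) z = 0 := by
  rw [dt_comp_scalar (hχ _) ((contDiff_norm_sq_snd (n := 1)).differentiable one_ne_zero _), dt_norm_sq_snd,
    mul_zero]

omit [FiniteDimensional ℝ E] in
/-- Radial profiles, spatial derivative: `∂ₑ χ(|x|²) = 2 χ'(|x|²) ⟪x, e⟫`. [folklore] -/
theorem dx_radial {χ : ℝ → ℝ} (hχ : Differentiable ℝ χ) (e : E) (z : ℝ × E) :
    dx e (fun y : ℝ × E => χ (‖y.2‖ ^ 2)) z = 2 * deriv χ (‖z.2‖ ^ 2) * ⟪z.2, e⟫ := by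
  rw [dx_comp_scalar (hχ _) ((contDiff_norm_sq_snd (n := 1)).differentiable one_ne_zero _), dx_norm_sq_snd]
  ring

/-- Radial profiles, gradient: `|∇ χ(|x|²)|² = 4 χ'(|x|²)² |x|²`. [folklore] -/
theorem gradSq_radial {χ : ℝ → ℝ} (hχ : Differentiable ℝ χ) (z : ℝ × E) :
    gradSq (fun y : ℝ × E => χ (‖y.2‖ ^ 2)) z = 4 * deriv χ (‖z.2‖ ^ 2) ^ 2 * ‖z.2‖ ^ 2 := by
  rw [gradSq_comp_scalar (hχ _) ((contDiff_norm_sq_snd (n := 1)).differentiable one_ne_zero _),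
    gradSq_norm_sq_snd]
  ring

/-- Radial profiles, Laplacian: `Δ χ(|x|²) = 4 χ''(|x|²) |x|² + 2n χ'(|x|²)`. [folklore] -/
theorem lap_radial {χ : ℝ → ℝ} (hχ : ContDiff ℝ 2 χ) (z : ℝ × E) :
    lap (fun y : ℝ × E => χ (‖y.2‖ ^ 2)) z =
      4 * deriv (deriv χ) (‖z.2‖ ^ 2) * ‖z.2‖ ^ 2 +
        2 * (Module.finrank ℝ E : ℝ) * deriv χ (‖z.2‖ ^ 2) := by
  rw [lap_comp_scalar isOpen_univ (mem_univ z) hχ (contDiff_norm_sq_snd.contDiffOn),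
    gradSq_norm_sq_snd, lap_norm_sq_snd]
  ring

end Profiles

/-! ### Products `η • v` with a vector field -/

section Smul

variable {E : Type*} [NormedAddCommGroup E] [InnerProductSpace ℝ E]
variable {F : Type*} [NormedAddCommGroup F] [NormedSpace ℝ F]

/-- `∂ₑ(η v) = η ∂ₑv + (∂ₑη) v`. [folklore] -/
theorem dx_smul {η : ℝ × E → ℝ} {v : ℝ × E → F} {z : ℝ × E} (hη : DifferentiableAt ℝ η z)
    (hv : DifferentiableAt ℝ v z) (e : E) :
    dx e (fun y => η y • v y) z = η z • dx e v z + dx e η z • v z := by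
  simp only [dx_apply]
  rw [fderiv_fun_smul hη hv]
  simp

/-- `∂ₜ(η v) = η ∂ₜv + (∂ₜη) v`. [folklore] -/
theorem dt_smul {η : ℝ × E → ℝ} {v : ℝ × E → F} {z : ℝ × E} (hη : DifferentiableAt ℝ η z)
    (hv : DifferentiableAt ℝ v z) :
    dt (fun y => η y • v y) z = η z • dt v z + dt η z • v z := by
  simp only [dt_apply]
  rw [fderiv_fun_smul hη hv]
  simp

variable [FiniteDimensional ℝ E]

/-- **Cauchy–Schwarz for the cross term**: `‖Σᵢ ∂ᵢη ∂ᵢv‖ ≤ √|∇η|² √|∇v|²`. [folklore] -/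
theorem norm_sum_dx_smul_dx_le (η : ℝ × E → ℝ) (v : ℝ × E → F) (z : ℝ × E) :
    ‖∑ i, dx (stdOrthonormalBasis ℝ E i) η z • dx (stdOrthonormalBasis ℝ E i) v z‖ ≤
      Real.sqrt (gradSq η z) * Real.sqrt (gradSq v z) := by
  calc ‖∑ i, dx (stdOrthonormalBasis ℝ E i) η z • dx (stdOrthonormalBasis ℝ E i) v z‖
      ≤ ∑ i, ‖dx (stdOrthonormalBasis ℝ E i) η z • dx (stdOrthonormalBasis ℝ E i) v z‖ :=
        norm_sum_le _ _
    _ = ∑ i, |dx (stdOrthonormalBasis ℝ E i) η z| * ‖dx (stdOrthonormalBasis ℝ E i) v z‖ := by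
        simp [norm_smul]
    _ ≤ Real.sqrt (∑ i, |dx (stdOrthonormalBasis ℝ E i) η z| ^ 2) *
          Real.sqrt (∑ i, ‖dx (stdOrthonormalBasis ℝ E i) v z‖ ^ 2) :=
        Real.sum_mul_le_sqrt_mul_sqrt _ _ _
    _ = Real.sqrt (gradSq η z) * Real.sqrt (gradSq v z) := by
        simp [gradSq, Real.norm_eq_abs, sq_abs]

/-- **Gradient of `η v`**: `|∇(ηv)|² ≤ 2 η² |∇v|² + 2 |∇η|² ‖v‖²`. [folklore] -/
theorem gradSq_smul_le {η : ℝ × E → ℝ} {v : ℝ × E → F} {z : ℝ × E}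
    (hη : DifferentiableAt ℝ η z) (hv : DifferentiableAt ℝ v z) :
    gradSq (fun y => η y • v y) z ≤ 2 * η z ^ 2 * gradSq v z + 2 * gradSq η z * ‖v z‖ ^ 2 := by
  simp only [gradSq, Finset.mul_sum, Finset.sum_mul, ← Finset.sum_add_distrib]
  refine Finset.sum_le_sum fun i _ => ?_
  rw [dx_smul hη hv]
  have h1 : ‖η z • dx (stdOrthonormalBasis ℝ E i) v z + dx (stdOrthonormalBasis ℝ E i) η z • v z‖ ≤
      |η z| * ‖dx (stdOrthonormalBasis ℝ E i) v z‖ + |dx (stdOrthonormalBasis ℝ E i) η z| * ‖v z‖ := by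
    refine (norm_add_le _ _).trans ?_
    simp [norm_smul]
  have h2 := sq_le_sq' (by
    linarith [norm_nonneg (η z • dx (stdOrthonormalBasis ℝ E i) v z +
      dx (stdOrthonormalBasis ℝ E i) η z • v z),
      mul_nonneg (abs_nonneg (η z)) (norm_nonneg (dx (stdOrthonormalBasis ℝ E i) v z)),
      mul_nonneg (abs_nonneg (dx (stdOrthonormalBasis ℝ E i) η z)) (norm_nonneg (v z))]) h1
  simp only [Real.norm_eq_abs, sq_abs]
  nlinarith [sq_nonneg (|η z| * ‖dx (stdOrthonormalBasis ℝ E i) v z‖ -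
    |dx (stdOrthonormalBasis ℝ E i) η z| * ‖v z‖), sq_abs (η z),
    sq_abs (dx (stdOrthonormalBasis ℝ E i) η z)]

/-- **The cut-off does not lose the gradient**: `η² |∇v|² ≤ 2 |∇(ηv)|² + 2 |∇η|² ‖v‖²`. [folklore] -/
theorem sq_mul_gradSq_le {η : ℝ × E → ℝ} {v : ℝ × E → F} {z : ℝ × E}
    (hη : DifferentiableAt ℝ η z) (hv : DifferentiableAt ℝ v z) :
    η z ^ 2 * gradSq v z ≤ 2 * gradSq (fun y => η y • v y) z + 2 * gradSq η z * ‖v z‖ ^ 2 := by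
  simp only [gradSq, Finset.mul_sum, Finset.sum_mul, ← Finset.sum_add_distrib]
  refine Finset.sum_le_sum fun i _ => ?_
  rw [dx_smul hη hv]
  -- `η ∂ᵢv = ∂ᵢ(ηv) - (∂ᵢη) v`
  have h1 : |η z| * ‖dx (stdOrthonormalBasis ℝ E i) v z‖ ≤
      ‖η z • dx (stdOrthonormalBasis ℝ E i) v z + dx (stdOrthonormalBasis ℝ E i) η z • v z‖ +
        |dx (stdOrthonormalBasis ℝ E i) η z| * ‖v z‖ := by
    have := norm_sub_le (η z • dx (stdOrthonormalBasis ℝ E i) v z +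
      dx (stdOrthonormalBasis ℝ E i) η z • v z) (dx (stdOrthonormalBasis ℝ E i) η z • v z)
    simp only [add_sub_cancel_right, norm_smul, Real.norm_eq_abs] at this
    exact this
  have h2 := sq_le_sq' (by
    linarith [norm_nonneg (η z • dx (stdOrthonormalBasis ℝ E i) v z +
      dx (stdOrthonormalBasis ℝ E i) η z • v z),
      mul_nonneg (abs_nonneg (η z)) (norm_nonneg (dx (stdOrthonormalBasis ℝ E i) v z)),
      mul_nonneg (abs_nonneg (dx (stdOrthonormalBasis ℝ E i) η z)) (norm_nonneg (v z))]) h1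
  simp only [Real.norm_eq_abs, sq_abs]
  nlinarith [sq_nonneg (‖η z • dx (stdOrthonormalBasis ℝ E i) v z +
      dx (stdOrthonormalBasis ℝ E i) η z • v z‖ - |dx (stdOrthonormalBasis ℝ E i) η z| * ‖v z‖),
    sq_abs (η z), sq_abs (dx (stdOrthonormalBasis ℝ E i) η z), mul_pow (|η z|) ‖dx (stdOrthonormalBasis ℝ E i) v z‖ 2]

end Smul

/-! ### The cut-off of the first Carleman argument (Seregin 2014, proofs of Lemmas A.1–A.2) -/

section CutoffFirst

variable (E : Type*) [NormedAddCommGroup E] [InnerProductSpace ℝ E] [FiniteDimensional ℝ E]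

/-- **The cut-off `η = φ_b(s) φ_t(s) φ_ρ(y)` of the first Carleman argument.** There are
constants `D, G, L ≥ 0` (depending only on `dim E`) such that for all `0 < s₁ < s₂` and `ρ ≥ 2`
there is a smooth `η : ℝ × E → ℝ` with: `η = 1` on `[s₂, 3/2] × B̄(0, ρ - 1)`; `tsupport η ⊆
[s₁, 7/4] × B̄(0, ρ - 1/2)` (so `η` is compactly supported in `]0, 2[ × E`); `0 ≤ η ≤ 1`;
`|∂ₜη| ≤ D/(s₂ - s₁)` on the bottom layer `[s₁, s₂] × B̄(0, ρ - 1/2)`, `|∂ₜη| ≤ D` on the top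
layer `[3/2, 7/4] × B̄(0, ρ - 1/2)` and `∂ₜη = 0` elsewhere; `|∇η|² ≤ G` and `|Δη| ≤ L` on the
annulus `[s₁, 7/4] × (B̄(0, ρ - 1/2) ∖ B(0, ρ - 1))` and `∇η = 0`, `Δη = 0` elsewhere
(Seregin 2014: `φ_ρ(y) = 0` for `|y| > ρ - 1/2`, `= 1` for `|y| < ρ - 1`; `φ_t(s) = 0` for
`7/4 < s`, `= 1` for `s < 3/2`; the bottom step `φ_ε`). [cite: Seregin2014, App. A.3, proof of Lemma A.2] -/
theorem exists_cutoff_first : ∃ D G L : ℝ, 0 ≤ D ∧ 0 ≤ G ∧ 0 ≤ L ∧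
    ∀ s₁ s₂ ρ : ℝ, 0 < s₁ → s₁ < s₂ → 2 ≤ ρ →
    ∃ η : ℝ × E → ℝ, ContDiff ℝ (⊤ : ℕ∞) η ∧
      (∀ z ∈ Icc s₂ (3 / 2) ×ˢ closedBall (0 : E) (ρ - 1), η z = 1) ∧
      tsupport η ⊆ Icc s₁ (7 / 4) ×ˢ closedBall (0 : E) (ρ - 1 / 2) ∧
      HasCompactSupport η ∧ (∀ z, 0 ≤ η z) ∧ (∀ z, η z ≤ 1) ∧
      (∀ z, |dt η z| ≤
        (Icc s₁ s₂ ×ˢ closedBall (0 : E) (ρ - 1 / 2)).indicator (fun _ => D / (s₂ - s₁)) z +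
        (Icc (3 / 2) (7 / 4) ×ˢ closedBall (0 : E) (ρ - 1 / 2)).indicator (fun _ => D) z) ∧
      (∀ z, gradSq η z ≤
        (Icc s₁ (7 / 4) ×ˢ (closedBall (0 : E) (ρ - 1 / 2) \ ball 0 (ρ - 1))).indicator
          (fun _ => G) z) ∧
      (∀ z, |lap η z| ≤
        (Icc s₁ (7 / 4) ×ˢ (closedBall (0 : E) (ρ - 1 / 2) \ ball 0 (ρ - 1))).indicator
          (fun _ => L) z) := by
  obtain ⟨D₁, D₂, hD₁, hD₂, hstep⟩ := exists_smooth_step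
  set n : ℝ := (Module.finrank ℝ E : ℝ) with hn
  have hn0 : 0 ≤ n := Nat.cast_nonneg _
  refine ⟨5 * D₁, 16 * D₁ ^ 2, 16 * D₂ + 2 * n * D₁, by positivity, by positivity,
    by positivity, fun s₁ s₂ ρ hs₁ hs₁₂ hρ => ?_⟩
  -- the three one-variable profiles
  obtain ⟨χb, hχb, hχb0, hχb1, hχbnn, hχble, hχb', -, hχb'0, -⟩ := hstep s₁ s₂ hs₁₂
  obtain ⟨χt, hχt, hχt0, hχt1, hχtnn, hχtle, hχt', -, hχt'0, -⟩ :=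
    hstep (3 / 2 : ℝ) (7 / 4) (by norm_num)
  set r₁ : ℝ := ρ - 1 with hr₁
  set r₂ : ℝ := ρ - 1 / 2 with hr₂
  have hr₁0 : 1 ≤ r₁ := by rw [hr₁]; linarith
  have hr₁₂ : r₁ ^ 2 < r₂ ^ 2 := by rw [hr₁, hr₂]; nlinarith
  have hgap : ρ / 2 ≤ r₂ ^ 2 - r₁ ^ 2 := by rw [hr₁, hr₂]; nlinarith
  have hgap0 : 0 < r₂ ^ 2 - r₁ ^ 2 := by linarith
  obtain ⟨χr, hχr, hχr0, hχr1, hχrnn, hχrle, hχr', hχr'', hχr'0, hχr''0⟩ :=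
    hstep (r₁ ^ 2) (r₂ ^ 2) hr₁₂
  -- time part `τ = χb (1 - χt)` and space part `σ = 1 - χr(|y|²)`
  set τ : ℝ → ℝ := fun s => χb s * (1 - χt s) with hτ
  have hτs : ContDiff ℝ (⊤ : ℕ∞) τ := hχb.mul (contDiff_const.sub hχt)
  have hτ1 : ContDiff ℝ 1 τ := hτs.of_le (by norm_cast)
  set η : ℝ × E → ℝ := fun z => τ z.1 * (1 - χr (‖z.2‖ ^ 2)) with hη
  have hσs : ContDiff ℝ (⊤ : ℕ∞) fun z : ℝ × E => 1 - χr (‖z.2‖ ^ 2) :=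
    contDiff_const.sub (hχr.comp contDiff_norm_sq_snd)
  have hηs : ContDiff ℝ (⊤ : ℕ∞) η := (hτs.comp contDiff_fst).mul hσs
  have hχrd : Differentiable ℝ χr := hχr.differentiable (by simp)
  have h1χrd : Differentiable ℝ fun u => 1 - χr u := by fun_prop
  have hχr2 : ContDiff ℝ 2 fun u => 1 - χr u := contDiff_const.sub (hχr.of_le (by norm_cast))
  -- values
  have hτnn : ∀ s, 0 ≤ τ s := fun s => mul_nonneg (hχbnn s) (by linarith [hχtle s])
  have hτle : ∀ s, τ s ≤ 1 := fun s => by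
    have := mul_le_mul (hχble s) (by linarith [hχtnn s] : 1 - χt s ≤ 1)
      (by linarith [hχtle s]) zero_le_one
    simpa [hτ] using this
  have hσnn : ∀ y : E, 0 ≤ 1 - χr (‖y‖ ^ 2) := fun y => by linarith [hχrle (‖y‖ ^ 2)]
  have hσle : ∀ y : E, 1 - χr (‖y‖ ^ 2) ≤ 1 := fun y => by linarith [hχrnn (‖y‖ ^ 2)]
  -- derivative of `τ`
  have hτd : ∀ s, deriv τ s = deriv χb s * (1 - χt s) - χb s * deriv χt s := by
    intro s
    have h : HasDerivAt τ (deriv χb s * (1 - χt s) + χb s * -deriv χt s) s :=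
      ((hχb.differentiable (by simp)) s).hasDerivAt.fun_mul
        (((hχt.differentiable (by simp)) s).hasDerivAt.const_sub 1)
    rw [h.deriv]; ring
  -- support
  have hsupp : tsupport η ⊆ Icc s₁ (7 / 4) ×ˢ closedBall (0 : E) (ρ - 1 / 2) := by
    refine closure_minimal (fun z hz => ?_) (isClosed_Icc.prod isClosed_closedBall)
    rcases z with ⟨s, y⟩
    simp only [mem_support, hη, hτ, ne_eq, mul_eq_zero, not_or] at hz
    obtain ⟨⟨hb, ht⟩, hr⟩ := hz
    refine ⟨⟨?_, ?_⟩, ?_⟩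
    · by_contra h; exact hb (hχb0 s (le_of_not_ge h))
    · by_contra h; exact ht (by rw [hχt1 s (le_of_not_ge h)]; simp)
    · rw [mem_closedBall, dist_zero_right]
      by_contra h
      have : χr (‖y‖ ^ 2) = 1 := hχr1 _ (by
        have h' : r₂ ≤ ‖y‖ := le_of_not_ge h
        exact pow_le_pow_left₀ (by linarith [hr₂.le, hr₂.ge]) h' 2)
      exact hr (by rw [this]; simp)
  have hηc : HasCompactSupport η :=
    HasCompactSupport.of_support_subset_isCompact
      (isCompact_Icc.prod (isCompact_closedBall (0 : E) (ρ - 1 / 2)))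
      (subset_closure.trans hsupp)
  refine ⟨η, hηs, ?_, hsupp, hηc, fun z => mul_nonneg (hτnn _) (hσnn _),
    fun z => (mul_le_mul (hτle _) (hσle _) (hσnn _) zero_le_one).trans (by norm_num), ?_, ?_, ?_⟩
  · -- `η = 1` on the plateau
    rintro ⟨s, y⟩ ⟨⟨hs1, hs2⟩, hy⟩
    rw [mem_closedBall, dist_zero_right] at hy
    have hb : χb s = 1 := hχb1 s hs1
    have ht : χt s = 0 := hχt0 s hs2
    have hr : χr (‖y‖ ^ 2) = 0 := hχr0 _ (by
      rw [hr₁] at *; exact pow_le_pow_left₀ (norm_nonneg _) hy 2)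
    simp [hη, hτ, hb, ht, hr]
  · -- `∂ₜη`
    intro z
    have hτfd : DifferentiableAt ℝ (fun y : ℝ × E => τ y.1) z :=
      ((hτs.comp contDiff_fst).differentiable (by simp)) z
    have hσd : DifferentiableAt ℝ (fun y : ℝ × E => 1 - χr (‖y.2‖ ^ 2)) z :=
      (hσs.differentiable (by simp)) z
    have hdt : dt η z = (1 - χr (‖z.2‖ ^ 2)) * deriv τ z.1 := by
      rw [hη, dt_mul hτfd hσd, dt_timeProfile hτ1,
        dt_radial (χ := fun u => 1 - χr u) h1χrd]
      ring
    have hI1 : 0 ≤ (Icc s₁ s₂ ×ˢ closedBall (0 : E) (ρ - 1 / 2)).indicator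
        (fun _ => 5 * D₁ / (s₂ - s₁)) z :=
      Set.indicator_nonneg (fun _ _ => by
        have : 0 < s₂ - s₁ := sub_pos.2 hs₁₂
        positivity) z
    have hI2 : 0 ≤ (Icc (3 / 2 : ℝ) (7 / 4) ×ˢ closedBall (0 : E) (ρ - 1 / 2)).indicator
        (fun _ => 5 * D₁) z := Set.indicator_nonneg (fun _ _ => by positivity) z
    by_cases hy : ‖z.2‖ ≤ ρ - 1 / 2
    swap
    · -- outside the ball `σ = 0`
      have hr : χr (‖z.2‖ ^ 2) = 1 := hχr1 _ (by
        exact pow_le_pow_left₀ (by linarith [hr₂.le, hr₂.ge]) (le_of_not_ge hy) 2)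
      rw [hdt, hr]
      simp only [sub_self, zero_mul, abs_zero]
      exact add_nonneg hI1 hI2
    have hyB : z.2 ∈ closedBall (0 : E) (ρ - 1 / 2) := by
      rw [mem_closedBall, dist_zero_right]; exact hy
    -- `|∂ₜη| ≤ |χb'| + |χt'|`
    have hb1 : |dt η z| ≤ |deriv χb z.1| + |deriv χt z.1| := by
      rw [hdt, hτd, abs_mul]
      have hσ1 : |1 - χr (‖z.2‖ ^ 2)| ≤ 1 := by
        rw [abs_le]; exact ⟨by linarith [hσnn z.2], hσle z.2⟩
      calc |1 - χr (‖z.2‖ ^ 2)| * |deriv χb z.1 * (1 - χt z.1) - χb z.1 * deriv χt z.1|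
          ≤ 1 * (|deriv χb z.1 * (1 - χt z.1)| + |χb z.1 * deriv χt z.1|) :=
            mul_le_mul hσ1 (abs_sub _ _) (abs_nonneg _) zero_le_one
        _ = |deriv χb z.1| * |1 - χt z.1| + |χb z.1| * |deriv χt z.1| := by
            rw [one_mul, abs_mul, abs_mul]
        _ ≤ |deriv χb z.1| * 1 + 1 * |deriv χt z.1| := by
            gcongr
            · rw [abs_le]; exact ⟨by linarith [hχtle z.1], by linarith [hχtnn z.1]⟩
            · rw [abs_le]; exact ⟨by linarith [hχbnn z.1], hχble z.1⟩
        _ = |deriv χb z.1| + |deriv χt z.1| := by ring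
    refine hb1.trans (add_le_add ?_ ?_)
    · by_cases hs : z.1 ∈ Icc s₁ s₂
      · rw [Set.indicator_of_mem (show z ∈ Icc s₁ s₂ ×ˢ closedBall (0 : E) (ρ - 1 / 2) from
          ⟨hs, hyB⟩)]
        refine (hχb' z.1).trans ?_
        exact div_le_div_of_nonneg_right (by linarith) (sub_pos.2 hs₁₂).le
      · rw [hχb'0 z.1 (by
          simp only [mem_Icc, not_and_or, not_le] at hs
          exact hs), abs_zero]
        exact hI1
    · by_cases hs : z.1 ∈ Icc (3 / 2 : ℝ) (7 / 4)
      · rw [Set.indicator_of_mem (show z ∈ Icc (3 / 2 : ℝ) (7 / 4) ×ˢ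
          closedBall (0 : E) (ρ - 1 / 2) from ⟨hs, hyB⟩)]
        refine (hχt' z.1).trans ?_
        norm_num; linarith
      · rw [hχt'0 z.1 (by
          simp only [mem_Icc, not_and_or, not_le] at hs
          exact hs), abs_zero]
        exact hI2
  · -- `|∇η|²`
    intro z
    have hτfd : DifferentiableAt ℝ (fun y : ℝ × E => τ y.1) z :=
      ((hτs.comp contDiff_fst).differentiable (by simp)) z
    have hσd : DifferentiableAt ℝ (fun y : ℝ × E => 1 - χr (‖y.2‖ ^ 2)) z :=
      (hσs.differentiable (by simp)) z
    have hgrad : gradSq η z = τ z.1 ^ 2 * (4 * deriv χr (‖z.2‖ ^ 2) ^ 2 * ‖z.2‖ ^ 2) := by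
      have h1 : ∀ e : E, dx e η z = τ z.1 * dx e (fun y : ℝ × E => 1 - χr (‖y.2‖ ^ 2)) z := by
        intro e
        rw [hη, dx_mul hτfd hσd, dx_timeProfile hτ1]
        ring
      have h2 : gradSq η z = τ z.1 ^ 2 * gradSq (fun y : ℝ × E => 1 - χr (‖y.2‖ ^ 2)) z := by
        simp only [gradSq, Finset.mul_sum]
        refine Finset.sum_congr rfl fun i _ => ?_
        rw [h1]
        simp only [Real.norm_eq_abs, sq_abs, abs_mul, mul_pow]
      rw [h2, gradSq_radial (χ := fun u => 1 - χr u) h1χrd]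
      congr 1
      simp [deriv_const_sub]
    have hI : 0 ≤ (Icc s₁ (7 / 4) ×ˢ (closedBall (0 : E) (ρ - 1 / 2) \ ball 0 (ρ - 1))).indicator
        (fun _ => 16 * D₁ ^ 2) z := Set.indicator_nonneg (fun _ _ => by positivity) z
    by_cases hz : z ∈ Icc s₁ (7 / 4) ×ˢ (closedBall (0 : E) (ρ - 1 / 2) \ ball 0 (ρ - 1))
    · rw [Set.indicator_of_mem hz, hgrad]
      have hy2 : ‖z.2‖ ≤ ρ - 1 / 2 := by
        have := hz.2.1; rwa [mem_closedBall, dist_zero_right] at this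
      have hq : |deriv χr (‖z.2‖ ^ 2)| * ‖z.2‖ ≤ 2 * D₁ := by
        calc |deriv χr (‖z.2‖ ^ 2)| * ‖z.2‖ ≤ D₁ / (r₂ ^ 2 - r₁ ^ 2) * (ρ - 1 / 2) :=
              mul_le_mul (hχr' _) hy2 (norm_nonneg _) (by positivity)
          _ ≤ D₁ / (ρ / 2) * ρ :=
              mul_le_mul (div_le_div_of_nonneg_left hD₁ (by positivity) hgap) (by linarith)
                (by linarith) (by positivity)
          _ = 2 * D₁ := by field_simp
      have hτ2 : τ z.1 ^ 2 ≤ 1 := by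
        have := hτle z.1; have := hτnn z.1; nlinarith
      calc τ z.1 ^ 2 * (4 * deriv χr (‖z.2‖ ^ 2) ^ 2 * ‖z.2‖ ^ 2)
          ≤ 1 * (4 * deriv χr (‖z.2‖ ^ 2) ^ 2 * ‖z.2‖ ^ 2) :=
            mul_le_mul_of_nonneg_right hτ2 (by positivity)
        _ = 4 * (|deriv χr (‖z.2‖ ^ 2)| * ‖z.2‖) ^ 2 := by rw [mul_pow, sq_abs]; ring
        _ ≤ 4 * (2 * D₁) ^ 2 := by gcongr
        _ = 16 * D₁ ^ 2 := by ring
    · -- off the annulus `∇η = 0`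
      refine le_of_eq_of_le ?_ hI
      rw [hgrad]
      simp only [mem_prod, mem_Icc, Set.mem_sdiff, mem_closedBall, dist_zero_right, mem_ball,
        not_lt] at hz
      by_cases hs : s₁ ≤ z.1 ∧ z.1 ≤ 7 / 4
      · -- then `y` is off the annulus, where `χr' = 0`
        have hy : ‖z.2‖ < ρ - 1 ∨ ρ - 1 / 2 < ‖z.2‖ := by
          by_contra h
          push Not at h
          exact hz ⟨hs, h.2, h.1⟩
        have h0 : deriv χr (‖z.2‖ ^ 2) = 0 := by
          refine hχr'0 _ ?_
          rcases hy with hy | hy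
          · left
            have : 0 ≤ ‖z.2‖ := norm_nonneg _
            rw [hr₁]; nlinarith
          · right
            rw [hr₂]; nlinarith
        rw [h0]; ring
      · -- else `τ = 0`
        have h0 : τ z.1 = 0 := by
          rcases not_and_or.1 hs with hs | hs
          · simp [hτ, hχb0 z.1 (le_of_not_ge hs)]
          · simp [hτ, hχt1 z.1 (le_of_not_ge hs)]
        rw [h0]; ring
  · -- `Δη`
    intro z
    have hσ2 : ContDiffOn ℝ 2 (fun y : ℝ × E => 1 - χr (‖y.2‖ ^ 2)) univ :=
      (hσs.of_le (by norm_cast)).contDiffOn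
    have hτf2 : ContDiffOn ℝ 2 (fun y : ℝ × E => τ y.1) univ :=
      ((hτs.comp contDiff_fst).of_le (by norm_cast)).contDiffOn
    have hlap : lap η z = τ z.1 * (-(4 * deriv (deriv χr) (‖z.2‖ ^ 2) * ‖z.2‖ ^ 2) -
        2 * n * deriv χr (‖z.2‖ ^ 2)) := by
      rw [hη, lap_mul isOpen_univ (mem_univ z) hτf2 hσ2, lap_timeProfile hτ1,
        lap_radial (χ := fun u => 1 - χr u) hχr2]
      have h0 : ∀ i, dx (stdOrthonormalBasis ℝ E i) (fun y : ℝ × E => τ y.1) z = 0 := fun i =>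
        dx_timeProfile hτ1 _ z
      simp only [h0, zero_mul, Finset.sum_const_zero, mul_zero, add_zero]
      have hd1 : deriv (fun u => 1 - χr u) = fun u => -deriv χr u := by
        funext u; simp [deriv_const_sub]
      have hd2 : deriv (deriv fun u => 1 - χr u) = fun u => -deriv (deriv χr) u := by
        rw [hd1]; funext u; simp
      rw [hd2, hd1]
      ring
    have hI : 0 ≤ (Icc s₁ (7 / 4) ×ˢ (closedBall (0 : E) (ρ - 1 / 2) \ ball 0 (ρ - 1))).indicator
        (fun _ => 16 * D₂ + 2 * n * D₁) z := Set.indicator_nonneg (fun _ _ => by positivity) z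
    by_cases hz : z ∈ Icc s₁ (7 / 4) ×ˢ (closedBall (0 : E) (ρ - 1 / 2) \ ball 0 (ρ - 1))
    · rw [Set.indicator_of_mem hz, hlap]
      have hy2 : ‖z.2‖ ≤ ρ - 1 / 2 := by
        have := hz.2.1; rwa [mem_closedBall, dist_zero_right] at this
      have hq1 : |deriv (deriv χr) (‖z.2‖ ^ 2)| * ‖z.2‖ ^ 2 ≤ 4 * D₂ := by
        calc |deriv (deriv χr) (‖z.2‖ ^ 2)| * ‖z.2‖ ^ 2
            ≤ D₂ / (r₂ ^ 2 - r₁ ^ 2) ^ 2 * (ρ - 1 / 2) ^ 2 :=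
              mul_le_mul (hχr'' _) (pow_le_pow_left₀ (norm_nonneg _) hy2 2) (by positivity)
                (by positivity)
          _ ≤ D₂ / (ρ / 2) ^ 2 * ρ ^ 2 :=
              mul_le_mul (div_le_div_of_nonneg_left hD₂ (by positivity)
                (pow_le_pow_left₀ (by positivity) hgap 2))
                (pow_le_pow_left₀ (by linarith) (by linarith) 2) (by positivity) (by positivity)
          _ = 4 * D₂ := by field_simp; ring
      have hq2 : |deriv χr (‖z.2‖ ^ 2)| ≤ D₁ := by
        refine (hχr' _).trans ?_
        rw [div_le_iff₀ hgap0]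
        nlinarith
      have hτa : |τ z.1| ≤ 1 := by rw [abs_le]; exact ⟨by linarith [hτnn z.1], hτle z.1⟩
      calc |τ z.1 * (-(4 * deriv (deriv χr) (‖z.2‖ ^ 2) * ‖z.2‖ ^ 2) -
            2 * n * deriv χr (‖z.2‖ ^ 2))|
          = |τ z.1| * |4 * deriv (deriv χr) (‖z.2‖ ^ 2) * ‖z.2‖ ^ 2 +
              2 * n * deriv χr (‖z.2‖ ^ 2)| := by
            rw [abs_mul, show -(4 * deriv (deriv χr) (‖z.2‖ ^ 2) * ‖z.2‖ ^ 2) -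
              2 * n * deriv χr (‖z.2‖ ^ 2) = -(4 * deriv (deriv χr) (‖z.2‖ ^ 2) * ‖z.2‖ ^ 2 +
              2 * n * deriv χr (‖z.2‖ ^ 2)) by ring, abs_neg]
        _ ≤ 1 * (|4 * deriv (deriv χr) (‖z.2‖ ^ 2) * ‖z.2‖ ^ 2| +
              |2 * n * deriv χr (‖z.2‖ ^ 2)|) :=
            mul_le_mul hτa (abs_add_le _ _) (abs_nonneg _) zero_le_one
        _ = 4 * (|deriv (deriv χr) (‖z.2‖ ^ 2)| * ‖z.2‖ ^ 2) + 2 * n * |deriv χr (‖z.2‖ ^ 2)| := by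
            rw [one_mul, abs_mul, abs_mul, abs_mul, abs_mul]
            simp only [abs_of_nonneg hn0, Nat.abs_ofNat, abs_pow, abs_norm]
            ring
        _ ≤ 4 * (4 * D₂) + 2 * n * D₁ := by gcongr
        _ = 16 * D₂ + 2 * n * D₁ := by ring
    · refine le_of_eq_of_le ?_ hI
      rw [hlap]
      simp only [mem_prod, mem_Icc, Set.mem_sdiff, mem_closedBall, dist_zero_right, mem_ball,
        not_lt] at hz
      by_cases hs : s₁ ≤ z.1 ∧ z.1 ≤ 7 / 4
      · have hy : ‖z.2‖ < ρ - 1 ∨ ρ - 1 / 2 < ‖z.2‖ := by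
          by_contra h
          push Not at h
          exact hz ⟨hs, h.2, h.1⟩
        have hy' : ‖z.2‖ ^ 2 < r₁ ^ 2 ∨ r₂ ^ 2 < ‖z.2‖ ^ 2 := by
          rcases hy with hy | hy
          · left
            have : 0 ≤ ‖z.2‖ := norm_nonneg _
            rw [hr₁]; nlinarith
          · right
            rw [hr₂]; nlinarith
        rw [hχr'0 _ hy', hχr''0 _ hy']
        simp
      · have h0 : τ z.1 = 0 := by
          rcases not_and_or.1 hs with hs | hs
          · simp [hτ, hχb0 z.1 (le_of_not_ge hs)]
          · simp [hτ, hχt1 z.1 (le_of_not_ge hs)]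
        rw [h0]; simp

end CutoffFirst

end Carleman

end Literature.Analysis.FluidPDE
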